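import Summits.BirchSwinnertonDyer.BirchSwinnertonDyer.Theses.GenusKolyvaginAtTwo
import Summits.BirchSwinnertonDyer.BirchSwinnertonDyer.Theorems.GenusKolyvaginAtTwoGenusPrimitiveSupplyAtTwoOfKernelsClosed
import HarnessLib

/-!
# SKELETON LINE `gz_appended_glue` for glue item 24951 `GenusPrimitiveSupplyAtTwoOfKernels` (route GenusKolyvaginAtTwo, support r208)

line-writer skeleton (linewriter-bsd-genuskolyattwo-1 g0); NOT leaf progress. The typed glue
`MultiGenusPrimitivityAtTwo → RankOneTwoConverse → RankOneTwoConverseOffSemistableAtTwo → ModularityExistsNewform → TwoParityDD →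
CasselsTatePairingRat → MazurRubinProp52Rat → GenusPrimitiveSupplyAtTwo` OMITS the one print input its informal text names, the
Gross–Zagier formula at every level (route item `GrossZagierAllLevels`, stmt-BirchSwinnertonDyer-24148, cite-level named fact
`gross_zagier`), and the tree ALREADY closes the glue modulo exactly that item:
`GenusKoly.genusPrimitiveSupplyAtTwoOfKernels_of_grossZagierAllLevels` (Theorems/GenusKolyvaginAtTwoGenusPrimitiveSupplyAtTwoOfKernelsClosed.lean,
seat bsd-line-gk2-p1 g3 / R-128 repair). This skeleton records that dependency machine-readably: ONE stub = item 24148 BY NAME,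
composition = that landed theorem. Census reading: 24951 closes the moment 24148 does (or the pen re-types the glue with
`GrossZagierAllLevels` appended — closer `GenusKoly.genusPrimitiveSupplyAtTwo_of_split'`, proved outright in the same file).
Sorries ONLY inside `stub_*`; nothing asserted; BSD is proved for no curve.
-/

set_option autoImplicit false
set_option linter.dupNamespace false

namespace Summit.BirchSwinnertonDyer.BirchSwinnertonDyer.Cruxes.GenusPrimitiveSupplyAtTwoOfKernels.GzAppendedGlue

open Summit.BirchSwinnertonDyer.BirchSwinnertonDyer.Theses.GenusKolyvaginAtTwo
  (GenusPrimitiveSupplyAtTwoOfKernels GrossZagierAllLevels)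

/-- [print · ITEM BY NAME = `GrossZagierAllLevels` 24148] the Gross–Zagier formula `gross_zagier N W K` at every level N, for every
W and every number field K (cite-level named fact; Gross–Zagier 1986 Thm I.6.3). [cite: GrossZagier1986, Thm. I.6.3] -/
theorem stub_grossZagierAllLevels : GrossZagierAllLevels := by
  sorry

/-- **Composition (kernel-checked): glue item `GenusPrimitiveSupplyAtTwoOfKernels`** (24951) BY NAME = the landed
`GenusKoly.genusPrimitiveSupplyAtTwoOfKernels_of_grossZagierAllLevels` applied to the one stub. [cite: GrossZagier1986, Thm. I.6.3]
[cite: MazurRubin2010, Prop. 5.2] [cite: GrossLMS1991, §3 (3.5), §4 (4.1)] -/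
theorem GenusPrimitiveSupplyAtTwoOfKernels_of : GenusPrimitiveSupplyAtTwoOfKernels :=
  Summit.BirchSwinnertonDyer.BirchSwinnertonDyer.Theorems.GenusKoly.genusPrimitiveSupplyAtTwoOfKernels_of_grossZagierAllLevels
    stub_grossZagierAllLevels

end Summit.BirchSwinnertonDyer.BirchSwinnertonDyer.Cruxes.GenusPrimitiveSupplyAtTwoOfKernels.GzAppendedGlue
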